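import Summits.ResolutionOfSingularities.ResolutionOfSingularities.Theorems.FrobeniusLadderFRationalResolutionCoarseChartLogRegularNhd
import Summits.ResolutionOfSingularities.ResolutionOfSingularities.Theorems.FrobeniusLadderFRationalResolutionUnitChartRank
import Summits.ResolutionOfSingularities.ResolutionOfSingularities.Theorems.FrobeniusLadderFRationalResolutionKummerCoverBasis
import Summits.ResolutionOfSingularities.ResolutionOfSingularities.Theorems.FrobeniusLadderFRationalResolutionLogRegularDescent
import Summits.ResolutionOfSingularities.ResolutionOfSingularities.Theorems.FrobeniusLadderFRationalResolutionFixedPointResolvableNhd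
import Mathlib.RingTheory.Spectrum.Prime.Chevalley
import HarnessLib

/-!
# Crux `FrobeniusLadder.FRationalResolution` (stmt-ResolutionOfSingularities-15317), line `redirect`,
# stub `stub_diagonalizableQuotientResolution` — **at an ARBITRARY point (tame or WILD) of a regular
# diagonalizable-quotient chart, `Spec S₀` is Kato-log-regular on a neighbourhood for a chart with
# unit exponents, hence the point has an affine neighbourhood WITH A RESOLUTION OF SINGULARITIES**
# (bricks W3'–W5' of memo MEMO-15317-leafhand2-g4 §2bis–§2ter assembled, ring level; every field)

`S` REGULAR of finite type over a field `k`, graded by a finite abelian group `A`; `𝔔` ANY prime of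
`S`, `B` its unit-degree subgroup, and assume every `b ∈ B` carries a GLOBAL homogeneous unit (true
after inverting one element of `S₀`, `…AwayUnits`). Then:
(1) `…CoarseChartLogRegularNhd`: `T = S^{(B)}` carries the homogeneous chart `φ(m) = x^m`,
log regular on `D(g') ∋ 𝔔 ∩ T`;
(2) `…KummerCoverBasis`: `S₀ ⊆ T` is finite free (flat, integral) — NO tameness;
(3) `…UnitChart`, `…UnitChartRank`: the unit-exponent chart `ψ(m,e) = x^m u^e` on `S₀` has
matching Kato ideals and rank terms at `ι⁻¹𝔮` / `𝔮`;
(4) `…LogRegularDescent`: Kato's (2.1) descends from `(T, φ)` at `𝔮` to `(S₀, ψ)` at `ι⁻¹𝔮`;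
(5) the image of `D(g')` in `Spec S₀` is open (going-down + finite presentation, Mathlib's
`PrimeSpectrum.isOpenMap_comap_of_hasGoingDown_of_finitePresentation`) and contains a basic open
`D(g) ∋ 𝔔 ∩ S₀`, every point of which lifts into `D(g')`;
(6) chart normalisation + Kato 1994 (10.4) (PROVED in the tree) resolve `Spec (S₀)_g`
(`…FixedPointResolvableNhd.hasResolution_away_of_forall_isLogRegularAt`).

* `exists_basicOpen_subset_image` — (5);
* **`exists_nhd_isLogRegularAt_of_units`** — a monomial chart on `S₀` log regular on `D(g) ∋ 𝔔 ∩ S₀`;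
* **`exists_hasResolution_away_of_units`** — `Spec (S₀)_g` has a resolution of singularities.

Honest label: the wild non-fixed case of the log-regular line at ring level (no stub closed: the
stub's `Scheme.HasResolution X` still needs the GLUING of these local resolutions — functorial
resolution / Bergh–Rydh destackification). No definitions, no named facts, no sorry.
[cite: Kato1994, Def. (2.1), Prop. (7.1), (10.4)] [cite: Matsumura1987, Thm. 23.7 (i), Thm. 15.1]
[folklore; cite: SGA3, Exp. VIII §4–5]
-/

noncomputable section

-- single-problem summit: the doubled namespace component is forced
set_option linter.dupNamespace false

open AlgebraicGeometry DirectSum Literature.AlgebraicGeometry.Resolution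
open Literature.AlgebraicGeometry.Resolution.DiagonalizableQuotient

namespace Summit.ResolutionOfSingularities.ResolutionOfSingularities.Theorems.FRationalResolution.WildLogRegularNhd

universe u w

/-! ## (5) Neighbourhood transfer along an open map of spectra -/

/-- **A basic open below, inside the image of a basic open above.** For `R → T` with going-down
and of finite presentation (so `Spec T → Spec R` is open) and `g' ∉ 𝔮₁`: there is `g ∈ R` outside
`𝔮₁ ∩ R` such that every prime `𝔮₀ ∌ g` of `R` is `𝔮 ∩ R` for a prime `𝔮 ∌ g'` of `T`.
[cite: StacksProject, Tag 00I1] [folklore] -/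
theorem exists_basicOpen_subset_image {R T : Type u} [CommRing R] [CommRing T] [Algebra R T]
    [Algebra.HasGoingDown R T] [Algebra.FinitePresentation R T] (g' : T) (𝔮₁ : Ideal T)
    [𝔮₁.IsPrime] (hg' : g' ∉ 𝔮₁) :
    ∃ g : R, g ∉ 𝔮₁.comap (algebraMap R T) ∧ ∀ (𝔮₀ : Ideal R) [𝔮₀.IsPrime], g ∉ 𝔮₀ →
      ∃ (𝔮 : Ideal T) (_ : 𝔮.IsPrime), g' ∉ 𝔮 ∧ 𝔮.comap (algebraMap R T) = 𝔮₀ := by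
  have hopen : IsOpen (PrimeSpectrum.comap (algebraMap R T) ''
      (PrimeSpectrum.basicOpen g' : Set (PrimeSpectrum T))) :=
    PrimeSpectrum.isOpenMap_comap_of_hasGoingDown_of_finitePresentation _
      (PrimeSpectrum.basicOpen g').2
  have hmem : PrimeSpectrum.comap (algebraMap R T) ⟨𝔮₁, ‹_›⟩ ∈
      PrimeSpectrum.comap (algebraMap R T) ''
        (PrimeSpectrum.basicOpen g' : Set (PrimeSpectrum T)) := ⟨⟨𝔮₁, ‹_›⟩, hg', rfl⟩
  obtain ⟨V, ⟨g, rfl⟩, hyV, hVU⟩ :=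
    PrimeSpectrum.isTopologicalBasis_basic_opens.exists_subset_of_mem_open hmem hopen
  refine ⟨g, hyV, fun 𝔮₀ _ hg𝔮₀ => ?_⟩
  obtain ⟨z, hz, hzy⟩ :=
    hVU (show (⟨𝔮₀, ‹_›⟩ : PrimeSpectrum R) ∈ (PrimeSpectrum.basicOpen g : Set _) from hg𝔮₀)
  exact ⟨z.asIdeal, z.isPrime, hz, by simpa using congrArg PrimeSpectrum.asIdeal hzy⟩

/-! ## The neighbourhood theorem at an arbitrary prime -/

variable {k : Type u} [Field k] {A : Type w} [DecidableEq A] [AddCommGroup A] {S : Type u}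
  [CommRing S] [Algebra k S] (𝒮 : A → Submodule k S) [GradedAlgebra 𝒮]

/-- **Log regularity of `Spec S₀` near ANY point, for a chart with unit exponents.** `S` regular
of finite type over a field `k`, graded by a finite abelian group `A`; `𝔔` any prime of `S` with
unit-degree subgroup `B` such that every `b ∈ B` carries a global homogeneous unit. Then there are
a homogeneous family `y : Fin N → S` (`y_l ∈ S_{c_l}`: parameters of degrees `∉ B` and units of
the degrees in `B`), the monomial chart `ψ(v) = y^v` on `{v ≥ 0 : Σ v_l c_l = 0}` into `S₀`, and
`g ∈ S₀ ∖ 𝔔` such that `(S₀, ψ)` is Kato-log-regular at every prime `𝔮₀ ∌ g` of `S₀`.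
[cite: Kato1994, Def. (2.1), Prop. (7.1)] [cite: Matsumura1987, Thm. 23.7 (i), Thm. 15.1]
[folklore; cite: SGA3, Exp. VIII §4–5] -/
theorem exists_nhd_isLogRegularAt_of_units [IsRegularRing S] [Algebra.FiniteType k S] [Finite A]
    (𝔔 : Ideal S) [𝔔.IsPrime] (B : AddSubgroup A) (hB : ∀ a : A, a ∈ B ↔ ∃ s ∈ 𝒮 a, s ∉ 𝔔)
    (hunits : ∀ b ∈ B, ∃ u ∈ 𝒮 b, IsUnit u) :
    ∃ (N : ℕ) (y : Fin N → S) (c : Fin N → A), (∀ l, y l ∈ 𝒮 (c l)) ∧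
      ∃ ψ : Multiplicative ↥(AddSubmonoid.nonneg (Fin N → ℤ) ⊓
          AddMonoidHom.mker (Fintype.linearCombination ℤ c).toAddMonoidHom) →* 𝒮 0,
        (∀ p, ((ψ (Multiplicative.ofAdd p) : 𝒮 0) : S) = ∏ l, y l ^ ((p : Fin N → ℤ) l).toNat) ∧
        ∃ g : 𝒮 0, (g : S) ∉ 𝔔 ∧ ∀ (𝔮₀ : Ideal (𝒮 0)) [𝔮₀.IsPrime], g ∉ 𝔮₀ →
          LogChart.IsLogRegularAt _ ψ 𝔮₀ := by
  classical
  have hA : AddMonoid.IsTorsion A := fun a => isOfFinAddOrder_of_finite a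
  -- (1) the coarse chart on `T = S^{(B)}`
  obtain ⟨𝒮', inst', h𝒮', hle, -, n, x, a, hxa, -, φ, hφ, g', hg', hreg⟩ :=
    CoarseChartLogRegularNhd.exists_coarse_chart_nhd_isLogRegularAt 𝒮 hA 𝔔 B hB
  let f : A →+ A ⧸ B := QuotientAddGroup.mk' B
  have hker : ∀ d : A, f d = 0 ↔ d ∈ B := fun d => QuotientAddGroup.eq_zero_iff d
  have h𝒮'' : ∀ c, 𝒮' c = ⨆ d ∈ {d : A | f d = c}, 𝒮 d := h𝒮'
  have hle' : ∀ d, 𝒮 d ≤ 𝒮' (f d) := hle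
  obtain ⟨ι, hι⟩ := CoarseningEtale.exists_ringHom_val_eq 𝒮 f 𝒮' h𝒮''
  letI := ι.toAlgebra
  have halg : ∀ s, (algebraMap (𝒮 0) (𝒮' 0) s : S) = s := hι
  -- (2) the Kummer cover is finite free
  haveI : Module.Flat (𝒮 0) (𝒮' 0) := KummerCoverBasis.flat_of_units 𝒮 f 𝒮' h𝒮'' halg B hker hunits
  haveI : Algebra.IsIntegral (𝒮 0) (𝒮' 0) :=
    KummerCoverBasis.isIntegral_of_units 𝒮 f 𝒮' h𝒮'' halg B hker hunits
  haveI : Module.Finite (𝒮 0) (𝒮' 0) :=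
    KummerCoverBasis.finite_of_units 𝒮 f 𝒮' h𝒮'' halg B hker hunits
  haveI : IsNoetherianRing (𝒮 0) := isNoetherianRing_gradeZero 𝒮 hA
  haveI : Finite (A ⧸ B) := Finite.of_surjective _ (QuotientAddGroup.mk'_surjective B)
  have hA' : AddMonoid.IsTorsion (A ⧸ B) := fun c => isOfFinAddOrder_of_finite c
  haveI : IsNoetherianRing (𝒮' 0) := isNoetherianRing_gradeZero 𝒮' hA'
  haveI : Algebra.FiniteType (𝒮 0) (𝒮' 0) := Module.Finite.finiteType (𝒮' 0)
  haveI : Algebra.FinitePresentation (𝒮 0) (𝒮' 0) :=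
    (Algebra.FinitePresentation.of_finiteType (R := 𝒮 0) (A := 𝒮' 0)).mp inferInstance
  -- units enumerating `B`
  haveI : Fintype B := Fintype.ofFinite B
  let eB : B ≃ Fin (Fintype.card B) := Fintype.equivFin B
  let b : Fin (Fintype.card B) → A := fun j => (eB.symm j : A)
  have hbB : ∀ j, b j ∈ B := fun j => (eB.symm j).2
  choose u hu huu using fun j => hunits (b j) (hbB j)
  have hb : ∀ j, f (b j) = 0 := fun j => (hker _).mpr (hbB j)
  have hbsurj : ∀ d : A, f d = 0 → ∃ j, b j = d := fun d hd =>
    ⟨eB ⟨d, (hker d).mp hd⟩, by simp [b]⟩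
  have hbfin : ∀ j, IsOfFinAddOrder (b j) := fun j => hA (b j)
  -- (3) the unit-exponent chart on `S₀`
  have hP : ∀ m, m ∈ (AddSubmonoid.nonneg (Fin n → ℤ) ⊓
      AddMonoidHom.mker (Fintype.linearCombination ℤ (fun i => (a i : A ⧸ B))).toAddMonoidHom) ↔
      0 ≤ m ∧ Fintype.linearCombination ℤ (fun i => f (a i)) m = 0 :=
    fun m => ChartNormalization.mem_chartMonoid_iff _ m
  have hy : ∀ l, Fin.append x u l ∈ 𝒮 (Fin.append a b l) := by
    intro l
    induction l using Fin.addCases with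
    | left i => simpa only [Fin.append_left] using (hxa i).2.1
    | right j => simpa only [Fin.append_right] using hu j
  have hP₀ : ∀ v, v ∈ (AddSubmonoid.nonneg (Fin (n + Fintype.card B) → ℤ) ⊓
      AddMonoidHom.mker (Fintype.linearCombination ℤ (Fin.append a b)).toAddMonoidHom) ↔
      0 ≤ v ∧ Fintype.linearCombination ℤ (Fin.append a b) v = 0 :=
    fun v => ChartNormalization.mem_chartMonoid_iff _ v
  obtain ⟨ψ, hψ⟩ := UnitChart.exists_monomialChart 𝒮 (Fin.append x u) (Fin.append a b) hy _ hP₀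
  -- (5) the neighbourhood
  obtain ⟨g, hg, hnbhd⟩ := exists_basicOpen_subset_image (R := 𝒮 0) (T := 𝒮' 0) g'
    (𝔔.comap (algebraMap (𝒮' 0) S)) hg'
  have hgQ : (g : S) ∉ 𝔔 := fun h => hg (by
    rw [Ideal.mem_comap, Ideal.mem_comap]
    change ((algebraMap (𝒮 0) (𝒮' 0) g : 𝒮' 0) : S) ∈ 𝔔
    rwa [halg])
  refine ⟨n + Fintype.card B, Fin.append x u, Fin.append a b, hy, ψ, hψ, g, hgQ,
    fun 𝔮₀ _ hg𝔮₀ => ?_⟩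
  obtain ⟨𝔮, h𝔮, hg'𝔮, h𝔮𝔮₀⟩ := hnbhd 𝔮₀ hg𝔮₀
  -- (4) descent at `𝔮`
  have hcomap : 𝔮.comap ι = 𝔮₀ := h𝔮𝔮₀
  subst hcomap
  haveI : 𝔮.LiesOver (𝔮.comap ι) := ⟨rfl⟩
  have hI := UnitChart.map_ideal_eq 𝒮 f 𝒮' hle' ι hι hu huu hb _ hP _ hP₀ φ hφ ψ hψ hbsurj 𝔮
  have hrank := UnitChartRank.rank_term_eq 𝒮 f 𝒮' hle' ι hι hu huu hb _ hP _ hP₀ φ hφ ψ hψ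
    hbsurj hbfin 𝔮
  exact LogRegularDescent.isLogRegularAt_of_flat_of_isIntegral _ ψ _ φ (𝔮.comap ι) 𝔮 hI hrank
    (hreg 𝔮 hg'𝔮)

/-- **Every point of a regular diagonalizable-quotient chart — tame or wild, fixed or not — has an
invariant affine neighbourhood WITH A RESOLUTION OF SINGULARITIES**, granted global homogeneous
units in the unit degrees (one localization of `S₀` away, `…AwayUnits`): there is `g ∈ S₀ ∖ 𝔔`
with `Scheme.HasResolution (Spec (S₀)_g)`, by chart normalisation and Kato 1994 (10.4)
(`Kato1994_logRegular_hasResolution_holds`, PROVED in the tree).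
[cite: Kato1994, Def. (2.1), (10.4)] [folklore; cite: SGA3, Exp. VIII §4–5] -/
theorem exists_hasResolution_away_of_units [IsRegularRing S] [Algebra.FiniteType k S] [Finite A]
    (𝔔 : Ideal S) [𝔔.IsPrime] (B : AddSubgroup A) (hB : ∀ a : A, a ∈ B ↔ ∃ s ∈ 𝒮 a, s ∉ 𝔔)
    (hunits : ∀ b ∈ B, ∃ u ∈ 𝒮 b, IsUnit u) :
    ∃ g : 𝒮 0, (g : S) ∉ 𝔔 ∧ Scheme.HasResolution (Spec (.of (Localization.Away g))) := by
  have hA : AddMonoid.IsTorsion A := fun a => isOfFinAddOrder_of_finite a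
  obtain ⟨N, y, c, -, ψ, -, g, hg, hreg⟩ := exists_nhd_isLogRegularAt_of_units 𝒮 𝔔 B hB hunits
  have hc : ∀ l, IsOfFinAddOrder (c l) := fun l => hA (c l)
  obtain ⟨P', e, hfg, hsat, hspan, hiff⟩ :=
    FixedPointResolvableNhd.exists_normalized_chart_forall c hc ψ
  haveI : IsNoetherianRing (𝒮 0) := isNoetherianRing_gradeZero 𝒮 hA
  refine ⟨g, hg, FixedPointResolvableNhd.hasResolution_away_of_forall_isLogRegularAt P'
    (ψ.comp (AddMonoidHom.toMultiplicative e.toAddMonoidHom)) hfg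
    (fun v m hm hmv => (hsat hmv).resolve_left (Nat.pos_iff_ne_zero.mp hm)) hspan g
    fun 𝔮 h𝔮 hg𝔮 => ?_⟩
  exact (@hiff 𝔮 h𝔮).mpr (@hreg 𝔮 h𝔮 hg𝔮)

end Summit.ResolutionOfSingularities.ResolutionOfSingularities.Theorems.FRationalResolution.WildLogRegularNhd

end
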